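import Mathlib
import HarnessLib
import Summits.ValiantsHypothesis.ValiantsHypothesis.Theorems.LacunarySymmetroidMatrixDescartesProductPlusOneRateWindowCellEveryK
import Summits.ValiantsHypothesis.ValiantsHypothesis.Theorems.LacunarySymmetroidMatrixDescartesProductPlusOneRowTowerKLogConvex
import Summits.ValiantsHypothesis.ValiantsHypothesis.Theorems.LacunarySymmetroidMatrixDescartesProductPlusOneLogConvexAlgebra

/-!
# LINE (A) `product_plus_one` — the ONE-BUMP CELL for every K: clouds and poles of ANY rates against ONE binomial knee of ANY rate

The every-K lift of the K = 3 one-bump count ✓ `slope_no_three_zeros_of_pull` (val-lit-p7): no rate threshold at all.  Support `d : Fin (n+2) → ℕ`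
(`StrictMono d`), rows `f_j = Σ_l C (a j l) X^(d l)`, window `(u,v)`, `0 < u`.  THE MENU: every row `j ≠ j₀` is BACKGROUND — a binomial POLE (bottom
letter + one tail letter, or two tail letters, opposite signs, its root outside `(u,v)`: `ψ₁ > 0`, `ψ₁ψ₃ − ψ₂² = 2ψ₁³ ≥ 0` by ✓ `rowPsiK13_single_eq` /
`rowPsiK13_pair_eq`) or an unswitched CLOUD (normalised `a₀ > 0`, tail `≤ 0` with an active letter, `f(v) > 0` — flip the row's sign if needed, `W` is even: `ψ₁ > 0`, `ψ₂² ≤ ψ₁ψ₃` by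
✓ `rowPsiK_logConvex_cloud`, `ψ₃ ≥ 0` by ✓ `rowPsiK3_ge` at `p = 0`); the row `j₀` is the BUMP — a binomial KNEE (two active letters of the same sign, any
gap: `ψ₁ < 0`, `ψ₁ψ₃ − ψ₂² = 2ψ₁³ < 0`).  THEN ★★ `oneBumpCellEveryK_wronskian_roots_le_two`: `W(∏_j f_j)` has AT MOST TWO roots in `(u,v)`.
Engine ★ `no_three_zeros_bump_vs_logConvex` (abstract θ-currency: `log(−b) − log P` is strictly θ-concave).

Honest framing: ONE W-cell family (helper; every K); two bumps need a magnitude law (memo §21.3 / §29); nothing closes a stub; `WronskianBudgetK3`,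
`OneChangeFloorK3`, `stub_classRowK3`, `stub_polyLaw`, 18050 `MatrixDescartes`, Conjecture B are NOT proved; `VP ≠ VNP` NOT proved.  No definitions, no named facts.
-/

set_option linter.dupNamespace false

namespace Summit.ValiantsHypothesis.ValiantsHypothesis.Theorems.LacunarySymmetroidMatrixDescartes

namespace ProductPlusOne

open Finset Set Polynomial
open scoped BigOperators Topology Polynomial

/-! ### §1 The abstract engine -/

/-- ★ **BUMP versus LOG-CONVEX BACKGROUND** (θ-currency on `[x₁,x₃] ⊂ (0,∞)`): `b < 0` with `θb = b₁`, `θb₁ = b₂`, `b·b₂ < b₁²`; `P > 0` with `θP = P₁`,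
`θP₁ = P₂`, `P₁² ≤ P·P₂` ⇒ `b + P` does not vanish at three points `x₁ < x₂ < x₃`. [this file's theorem] -/
theorem no_three_zeros_bump_vs_logConvex (b b₁ b₂ P P₁ P₂ : ℝ → ℝ) {x₁ x₂ x₃ : ℝ} (h0 : 0 < x₁) (h12 : x₁ < x₂) (h23 : x₂ < x₃)
    (hb : ∀ x ∈ Set.Icc x₁ x₃, b x < 0) (hdb : ∀ x ∈ Set.Icc x₁ x₃, HasDerivAt b (b₁ x / x) x)
    (hdb₁ : ∀ x ∈ Set.Icc x₁ x₃, HasDerivAt b₁ (b₂ x / x) x) (hblc : ∀ x ∈ Set.Icc x₁ x₃, b x * b₂ x < b₁ x ^ 2)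
    (hP : ∀ x ∈ Set.Icc x₁ x₃, 0 < P x) (hdP : ∀ x ∈ Set.Icc x₁ x₃, HasDerivAt P (P₁ x / x) x)
    (hdP₁ : ∀ x ∈ Set.Icc x₁ x₃, HasDerivAt P₁ (P₂ x / x) x) (hPlc : ∀ x ∈ Set.Icc x₁ x₃, P₁ x ^ 2 ≤ P x * P₂ x)
    (hzero : ∀ x ∈ ({x₁, x₂, x₃} : Set ℝ), b x + P x = 0) : False := by
  have hx0 : ∀ x ∈ Set.Icc x₁ x₃, 0 < x := fun x hx => h0.trans_le hx.1
  have hFzero : ∀ x ∈ ({x₁, x₂, x₃} : Set ℝ), Real.log (-b x) - Real.log (P x) = 0 := by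
    intro x hx
    have : -b x = P x := by linarith [hzero x hx]
    rw [this, sub_self]
  have hFderiv : ∀ x ∈ Set.Icc x₁ x₃, HasDerivAt (fun t => Real.log (-b t) - Real.log (P t)) ((b₁ x / b x - P₁ x / P x) / x) x := by
    intro x hx
    have hx' := hx0 x hx
    have h1' : HasDerivAt (fun t => -b t) (-(b₁ x / x)) x := (hdb x hx).neg
    have h1 := h1'.log (by have := hb x hx; linarith)
    have h2 := (hdP x hx).log (hP x hx).ne'
    refine (h1.sub h2).congr_deriv ?_
    have : b x ≠ 0 := (hb x hx).ne
    have : P x ≠ 0 := (hP x hx).ne'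
    have : x ≠ 0 := hx'.ne'
    field_simp
  have hFcont : ∀ y z, x₁ ≤ y → z ≤ x₃ → ContinuousOn (fun t => Real.log (-b t) - Real.log (P t)) (Set.Icc y z) :=
    fun y z hy hz t ht => (hFderiv t ⟨hy.trans ht.1, ht.2.trans hz⟩).continuousAt.continuousWithinAt
  have hrolle : ∀ y z, x₁ ≤ y → y < z → z ≤ x₃ →
      Real.log (-b y) - Real.log (P y) = 0 → Real.log (-b z) - Real.log (P z) = 0 →
        ∃ η ∈ Set.Ioo y z, b₁ η / b η - P₁ η / P η = 0 := by
    intro y z hy hyz hz hFy hFz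
    obtain ⟨η, hη, hη'⟩ := exists_hasDerivAt_eq_zero hyz (hFcont y z hy hz) (hFy.trans hFz.symm)
      (fun t ht => hFderiv t ⟨hy.trans ht.1.le, ht.2.le.trans hz⟩)
    refine ⟨η, hη, ?_⟩
    rcases div_eq_zero_iff.1 hη' with h | h
    · exact h
    · exact absurd h (hx0 η ⟨hy.trans hη.1.le, hη.2.le.trans hz⟩).ne'
  obtain ⟨η₁, hη₁, hG1⟩ := hrolle x₁ x₂ le_rfl h12 h23.le (hFzero x₁ (by simp)) (hFzero x₂ (by simp))
  obtain ⟨η₂, hη₂, hG2⟩ := hrolle x₂ x₃ h12.le h23 le_rfl (hFzero x₂ (by simp)) (hFzero x₃ (by simp))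
  have hη12 : η₁ < η₂ := hη₁.2.trans hη₂.1
  have hGderiv : ∀ x ∈ Set.Icc x₁ x₃, ∃ D : ℝ, D < 0 ∧ HasDerivAt (fun t => b₁ t / b t - P₁ t / P t) D x := by
    intro x hx
    have hx' := hx0 x hx
    have hbx := hb x hx
    have hPx := hP x hx
    have hquot := ((hdb₁ x hx).div (hdb x hx) hbx.ne).sub ((hdP₁ x hx).div (hdP x hx) hPx.ne')
    have hris := hblc x hx
    have hcl := hPlc x hx
    refine ⟨(b₂ x * b x - b₁ x ^ 2) / (x * b x ^ 2) - (P₂ x * P x - P₁ x ^ 2) / (x * P x ^ 2), ?_, ?_⟩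
    · have t1 : (b₂ x * b x - b₁ x ^ 2) / (x * b x ^ 2) < 0 :=
        div_neg_of_neg_of_pos (by linarith) (mul_pos hx' (sq_pos_iff.mpr hbx.ne))
      have t2 : 0 ≤ (P₂ x * P x - P₁ x ^ 2) / (x * P x ^ 2) := div_nonneg (by linarith) (by positivity)
      linarith
    · refine (hquot.congr_of_eventuallyEq (Filter.Eventually.of_forall fun t => ?_)).congr_deriv ?_
      · simp only [Pi.sub_apply, Pi.div_apply]
      · have : b x ≠ 0 := hbx.ne
        have : P x ≠ 0 := hPx.ne'
        have : x ≠ 0 := hx'.ne'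
        field_simp
  have hGcont : ContinuousOn (fun t => b₁ t / b t - P₁ t / P t) (Set.Icc η₁ η₂) := fun t ht => by
    obtain ⟨D, _, hD⟩ := hGderiv t ⟨hη₁.1.le.trans ht.1, ht.2.trans hη₂.2.le⟩
    exact hD.continuousAt.continuousWithinAt
  obtain ⟨ξ, hξ, hξ'⟩ := exists_deriv_eq_slope _ hη12 hGcont (fun t ht => by
    obtain ⟨D, _, hD⟩ := hGderiv t ⟨hη₁.1.le.trans ht.1.le, ht.2.le.trans hη₂.2.le⟩
    exact hD.differentiableAt.differentiableWithinAt)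
  obtain ⟨D, hDneg, hD⟩ := hGderiv ξ ⟨hη₁.1.le.trans hξ.1.le, hξ.2.le.trans hη₂.2.le⟩
  rw [hD.deriv, hG1, hG2, sub_zero, zero_div] at hξ'
  exact hDneg.ne hξ'

/-! ### §2 Per-row laws in the K-tower -/

section RowLaws

variable {n : ℕ} (lam : Fin n → ℕ) (B : Fin n → ℝ)

/-- A two-letter tail with no bottom letter (`A = 0`, any signs) also has `ψ₁ψ₃ − ψ₂² = 2ψ₁³`. [this file's lemma] -/
theorem rowPsiK13_pair_eq (i j : Fin n) (hij : i ≠ j) (hB : ∀ l, l ≠ i → l ≠ j → B l = 0) {x : ℝ}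
    (hF : (0 : ℝ) - ∑ l, B l * x ^ (lam l) ≠ 0) :
    rowPsiK1 lam 0 B x * rowPsiK3 lam 0 B x - rowPsiK2 lam 0 B x ^ 2 = 2 * rowPsiK1 lam 0 B x ^ 3 := by
  have hF2 : (0 : ℝ) - B i * x ^ (lam i) - B j * x ^ (lam j) ≠ 0 := by rwa [row_pair lam 0 B i j hij hB] at hF
  unfold rowPsiK3 rowPsiK2 rowPsiK1 rowUK
  simp only [rowHK_pair lam B i j hij hB, row_pair lam 0 B i j hij hB]
  field_simp
  ring

end RowLaws

/-- **BACKGROUND ROW LAW**: a background menu row has, on `(u,v)`, a non-vanishing stripped form, `ψ₁ > 0`, `ψ₂² ≤ ψ₁ψ₃` and `ψ₃ ≥ 0`. [this file's theorem] -/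
theorem oneBump_background_law {n : ℕ} (d : Fin (n + 2) → ℕ) (hd : StrictMono d) (b : Fin (n + 2) → ℝ) {u v : ℝ} (hu : 0 < u)
    (hrowj :
      ((∃ l₀ : Fin (n + 1), (∀ l, l ≠ l₀ → b l.succ = 0) ∧ b 0 * b l₀.succ < 0 ∧
          0 ≤ (∑ l, C (b l) * X ^ (d l) : ℝ[X]).eval u * (∑ l, C (b l) * X ^ (d l) : ℝ[X]).eval v) ∨
      (∃ i i' : Fin (n + 1), i < i' ∧ b 0 = 0 ∧ (∀ l, l ≠ i → l ≠ i' → b l.succ = 0) ∧ b i.succ * b i'.succ < 0 ∧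
          0 ≤ (∑ l, C (b l) * X ^ (d l) : ℝ[X]).eval u * (∑ l, C (b l) * X ^ (d l) : ℝ[X]).eval v) ∨
      (0 < b 0 ∧ (∀ l : Fin (n + 1), b l.succ ≤ 0) ∧ (∃ l : Fin (n + 1), b l.succ ≠ 0) ∧
          0 < (∑ l, C (b l) * X ^ (d l) : ℝ[X]).eval v)))
    {x : ℝ} (hx : x ∈ Ioo u v) :
    b 0 - ∑ l : Fin (n + 1), (-(b l.succ)) * x ^ (d l.succ - d 0) ≠ 0 ∧ 0 < rowPsiK1 (fun l : Fin (n + 1) => d l.succ - d 0) (b 0) (fun l : Fin (n + 1) => -(b l.succ)) x ∧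
    rowPsiK2 (fun l : Fin (n + 1) => d l.succ - d 0) (b 0) (fun l : Fin (n + 1) => -(b l.succ)) x ^ 2 ≤ rowPsiK1 (fun l : Fin (n + 1) => d l.succ - d 0) (b 0) (fun l : Fin (n + 1) => -(b l.succ)) x * rowPsiK3 (fun l : Fin (n + 1) => d l.succ - d 0) (b 0) (fun l : Fin (n + 1) => -(b l.succ)) x ∧ 0 ≤ rowPsiK3 (fun l : Fin (n + 1) => d l.succ - d 0) (b 0) (fun l : Fin (n + 1) => -(b l.succ)) x := by
  have hd0 : ∀ l, d 0 ≤ d l := fun l => hd.monotone (Fin.zero_le l)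
  have hx0 : 0 < x := hu.trans hx.1
  set lam : Fin (n + 1) → ℕ := fun l => d l.succ - d 0 with hlam
  set B : Fin (n + 1) → ℝ := fun l => -(b l.succ) with hBdef
  have hlam_ne : ∀ l : Fin (n + 1), lam l ≠ 0 := by
    intro l
    have : d 0 < d l.succ := hd (Fin.succ_pos l)
    simp only [hlam]; omega
  -- `ψ₃ ≥ 0` from `ψ₁ > 0` and `ψ₁ψ₃ ≥ ψ₂²`
  have psi3_of : ∀ {A' : ℝ} {B' : Fin (n + 1) → ℝ}, 0 < rowPsiK1 lam A' B' x →
      rowPsiK2 lam A' B' x ^ 2 ≤ rowPsiK1 lam A' B' x * rowPsiK3 lam A' B' x → 0 ≤ rowPsiK3 lam A' B' x := by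
    intro A' B' h1 hlc
    by_contra hcon
    push Not at hcon
    have := mul_neg_of_pos_of_neg h1 hcon
    nlinarith [sq_nonneg (rowPsiK2 lam A' B' x)]
  rcases hrowj with ⟨l₀, hzero, hpole, hend⟩ | ⟨i, i', hii', hb0, hzero, hneg, hend⟩ | hcloud
  · have hbase := rowLawsAt_single_pole d hd b hu 0 l₀ hzero hpole (Nat.zero_le _) hend hx
    have hF := hbase.1
    have hBz : ∀ l, l ≠ l₀ → B l = 0 := fun l hl => by simp [hBdef, hzero l hl]
    have hAB : 0 < b 0 * B l₀ := by simp only [hBdef]; nlinarith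
    have hψ : 0 < rowPsiK1 lam (b 0) B x := rowPsiK1_single_pos lam (b 0) B l₀ hBz hx0 (hlam_ne l₀) hAB hF
    have h13 := rowPsiK13_single_eq lam (b 0) B l₀ hBz x
    have hcube : 0 < rowPsiK1 lam (b 0) B x ^ 3 := by positivity
    have hlc : rowPsiK2 lam (b 0) B x ^ 2 ≤ rowPsiK1 lam (b 0) B x * rowPsiK3 lam (b 0) B x := by linarith
    exact ⟨hF, hψ, hlc, psi3_of hψ hlc⟩
  · have hbase := rowLawsAt_pair_pole d hd b hu 0 i i' hii' hb0 hzero hneg (Nat.zero_le _) hend hx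
    have hF := hbase.1
    have hF0 : (0 : ℝ) - ∑ l, B l * x ^ (lam l) ≠ 0 := by have h := hF; rwa [hb0] at h
    have hij : (i : Fin (n + 1)) ≠ i' := ne_of_lt hii'
    have hBz : ∀ l, l ≠ i → l ≠ i' → B l = 0 := fun l h1 h2 => by simp [hBdef, hzero l h1 h2]
    have hrate : lam i ≠ lam i' := by
      intro h
      have : d i.succ = d i'.succ := by have := hd0 i.succ; have := hd0 i'.succ; simp only [hlam] at h; omega
      exact hij (Fin.succ_injective _ (hd.injective this))
    have hBB : B i * B i' < 0 := by simp only [hBdef]; nlinarith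
    have hψ : 0 < rowPsiK1 lam 0 B x := rowPsiK1_pair_pos lam B i i' hij hBz hx0 hrate hBB hF0
    have h13 := rowPsiK13_pair_eq lam B i i' hij hBz hF0
    have hcube : 0 < rowPsiK1 lam 0 B x ^ 3 := by positivity
    have hlc : rowPsiK2 lam 0 B x ^ 2 ≤ rowPsiK1 lam 0 B x * rowPsiK3 lam 0 B x := by linarith
    rw [hb0]
    exact ⟨hF0, hψ, hlc, psi3_of hψ hlc⟩
  · obtain ⟨hc0, hle, hne, hcv⟩ := hcloud
    have hv : 0 < v := hu.trans (hx.1.trans hx.2)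
    have hB0 : ∀ l, 0 ≤ B l := fun l => by simp only [hBdef]; linarith [hle l]
    have hposg : 0 < b 0 - ∑ l : Fin (n + 1), B l * x ^ (lam l) := by
      rw [eval_rowK_eq d hd0 b v] at hcv
      have h3 : 0 < b 0 - ∑ l : Fin (n + 1), (-(b l.succ)) * v ^ (lam l) := (mul_pos_iff_of_pos_left (pow_pos hv _)).1 hcv
      have hmono : ∑ l : Fin (n + 1), (-(b l.succ)) * x ^ (lam l) ≤ ∑ l : Fin (n + 1), (-(b l.succ)) * v ^ (lam l) :=
        Finset.sum_le_sum fun l _ => mul_le_mul_of_nonneg_left (pow_le_pow_left₀ hx0.le hx.2.le _) (hB0 l)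
      simp only [hBdef]; linarith
    have hlc := rowPsiK_logConvex_cloud lam (b 0) B hx0 hB0 hposg
    have huK := rowUK_pos lam (b 0) B hposg
    obtain ⟨l₁, hl₁'⟩ := hne
    have hl₁ : b l₁.succ < 0 := lt_of_le_of_ne (hle l₁) hl₁'
    have hH2 : 0 < rowHK lam 2 B x := by
      unfold rowHK
      refine Finset.sum_pos' (fun l _ => mul_nonneg (mul_nonneg (by positivity) (hB0 l)) (pow_pos hx0 _).le)
        ⟨l₁, Finset.mem_univ _, ?_⟩
      have hl1 : (0 : ℝ) < ((lam l₁ : ℕ) : ℝ) := by exact_mod_cast Nat.pos_of_ne_zero (hlam_ne l₁)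
      have hBl : 0 < B l₁ := by show 0 < -(b l₁.succ); linarith
      exact mul_pos (mul_pos (by positivity) hBl) (pow_pos hx0 _)
    have hH1 := rowHK_nonneg lam B 1 hx0 hB0
    have hψ1 : 0 < rowPsiK1 lam (b 0) B x := by unfold rowPsiK1; positivity
    exact ⟨hposg.ne', hψ1, hlc, psi3_of hψ1 hlc⟩

/-- **BUMP ROW LAW**: a binomial knee has, for `x > 0`, a non-vanishing stripped form, `ψ₁ < 0` and `ψ₁ψ₃ < ψ₂²`. [this file's theorem] -/
theorem oneBump_bump_law {n : ℕ} (d : Fin (n + 2) → ℕ) (hd : StrictMono d) (b : Fin (n + 2) → ℝ)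
    (hrowj :
      ((∃ l₀ : Fin (n + 1), (∀ l, l ≠ l₀ → b l.succ = 0) ∧ 0 < b 0 * b l₀.succ) ∨
      (∃ i i' : Fin (n + 1), i < i' ∧ b 0 = 0 ∧ (∀ l, l ≠ i → l ≠ i' → b l.succ = 0) ∧ 0 < b i.succ * b i'.succ)))
    {x : ℝ} (hx0 : 0 < x) :
    b 0 - ∑ l : Fin (n + 1), (-(b l.succ)) * x ^ (d l.succ - d 0) ≠ 0 ∧ rowPsiK1 (fun l : Fin (n + 1) => d l.succ - d 0) (b 0) (fun l : Fin (n + 1) => -(b l.succ)) x < 0 ∧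
    rowPsiK1 (fun l : Fin (n + 1) => d l.succ - d 0) (b 0) (fun l : Fin (n + 1) => -(b l.succ)) x * rowPsiK3 (fun l : Fin (n + 1) => d l.succ - d 0) (b 0) (fun l : Fin (n + 1) => -(b l.succ)) x < rowPsiK2 (fun l : Fin (n + 1) => d l.succ - d 0) (b 0) (fun l : Fin (n + 1) => -(b l.succ)) x ^ 2 := by
  have hd0 : ∀ l, d 0 ≤ d l := fun l => hd.monotone (Fin.zero_le l)
  set lam : Fin (n + 1) → ℕ := fun l => d l.succ - d 0 with hlam
  set B : Fin (n + 1) → ℝ := fun l => -(b l.succ) with hBdef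
  have hlam_ne : ∀ l : Fin (n + 1), lam l ≠ 0 := by
    intro l
    have : d 0 < d l.succ := hd (Fin.succ_pos l)
    simp only [hlam]; omega
  rcases hrowj with ⟨l₀, hzero, hknee⟩ | ⟨i, i', hii', hb0, hzero, hpos⟩
  · have hBz : ∀ l, l ≠ l₀ → B l = 0 := fun l hl => by simp [hBdef, hzero l hl]
    have hF : b 0 - ∑ l : Fin (n + 1), B l * x ^ (lam l) ≠ 0 := by
      rw [row_single lam (b 0) B l₀ hBz]
      simp only [hBdef]
      intro h
      have h' : b 0 * b 0 + b 0 * b l₀.succ * x ^ (lam l₀) = 0 := by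
        have : b 0 * (b 0 - -(b l₀.succ) * x ^ (lam l₀)) = 0 := by rw [h, mul_zero]
        linarith [this]
      nlinarith [mul_self_nonneg (b 0), mul_pos hknee (pow_pos hx0 (lam l₀))]
    have hAB : b 0 * B l₀ < 0 := by simp only [hBdef]; nlinarith
    have hψ : rowPsiK1 lam (b 0) B x < 0 := rowPsiK1_single_neg lam (b 0) B l₀ hBz hx0 (hlam_ne l₀) hAB hF
    have h13 := rowPsiK13_single_eq lam (b 0) B l₀ hBz x
    have hcube : rowPsiK1 lam (b 0) B x ^ 3 < 0 := by
      have hn : 0 < -rowPsiK1 lam (b 0) B x := by linarith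
      have := pow_pos hn 3
      nlinarith
    exact ⟨hF, hψ, by linarith⟩
  · have hij : (i : Fin (n + 1)) ≠ i' := ne_of_lt hii'
    have hBz : ∀ l, l ≠ i → l ≠ i' → B l = 0 := fun l h1 h2 => by simp [hBdef, hzero l h1 h2]
    have hrate : lam i ≠ lam i' := by
      intro h
      have : d i.succ = d i'.succ := by have := hd0 i.succ; have := hd0 i'.succ; simp only [hlam] at h; omega
      exact hij (Fin.succ_injective _ (hd.injective this))
    have hF0 : (0 : ℝ) - ∑ l, B l * x ^ (lam l) ≠ 0 := by
      rw [row_pair lam 0 B i i' hij hBz]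
      simp only [hBdef]
      intro h
      have h' : b i.succ * b i.succ * x ^ (lam i) + b i.succ * b i'.succ * x ^ (lam i') = 0 := by
        have : b i.succ * ((0 : ℝ) - -(b i.succ) * x ^ (lam i) - -(b i'.succ) * x ^ (lam i')) = 0 := by rw [h, mul_zero]
        linarith [this]
      nlinarith [mul_nonneg (mul_self_nonneg (b i.succ)) (pow_pos hx0 (lam i)).le, mul_pos hpos (pow_pos hx0 (lam i'))]
    have hBB : 0 < B i * B i' := by simp only [hBdef]; nlinarith
    have hψ : rowPsiK1 lam 0 B x < 0 := rowPsiK1_pair_neg lam B i i' hij hBz hx0 hrate hBB hF0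
    have h13 := rowPsiK13_pair_eq lam B i i' hij hBz hF0
    have hcube : rowPsiK1 lam 0 B x ^ 3 < 0 := by
      have hn : 0 < -rowPsiK1 lam 0 B x := by linarith
      have := pow_pos hn 3
      nlinarith
    rw [hb0]
    exact ⟨hF0, hψ, by linarith⟩

/-- ★★ **THE ONE-BUMP CELL FOR EVERY K**: background rows (binomial poles of any rate with their root outside the window, unswitched clouds of any rates)
and ONE binomial knee row `j₀` of any rate ⇒ `W(∏_j f_j)` has AT MOST TWO roots in `(u,v)`. [this file's theorem] -/
theorem oneBumpCellEveryK_wronskian_roots_le_two {m n : ℕ} (d : Fin (n + 2) → ℕ) (hd : StrictMono d)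
    (a : Fin m → Fin (n + 2) → ℝ) {u v : ℝ} (hu : 0 < u) (j₀ : Fin m)
    (hbump :
      ((∃ l₀ : Fin (n + 1), (∀ l, l ≠ l₀ → a j₀ l.succ = 0) ∧ 0 < a j₀ 0 * a j₀ l₀.succ) ∨
      (∃ i i' : Fin (n + 1), i < i' ∧ a j₀ 0 = 0 ∧ (∀ l, l ≠ i → l ≠ i' → a j₀ l.succ = 0) ∧ 0 < a j₀ i.succ * a j₀ i'.succ)))
    (hrow : ∀ j, j ≠ j₀ →
      ((∃ l₀ : Fin (n + 1), (∀ l, l ≠ l₀ → a j l.succ = 0) ∧ a j 0 * a j l₀.succ < 0 ∧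
          0 ≤ (∑ l, C (a j l) * X ^ (d l) : ℝ[X]).eval u * (∑ l, C (a j l) * X ^ (d l) : ℝ[X]).eval v) ∨
      (∃ i i' : Fin (n + 1), i < i' ∧ a j 0 = 0 ∧ (∀ l, l ≠ i → l ≠ i' → a j l.succ = 0) ∧ a j i.succ * a j i'.succ < 0 ∧
          0 ≤ (∑ l, C (a j l) * X ^ (d l) : ℝ[X]).eval u * (∑ l, C (a j l) * X ^ (d l) : ℝ[X]).eval v) ∨
      (0 < a j 0 ∧ (∀ l : Fin (n + 1), a j l.succ ≤ 0) ∧ (∃ l : Fin (n + 1), a j l.succ ≠ 0) ∧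
          0 < (∑ l, C (a j l) * X ^ (d l) : ℝ[X]).eval v))) :
    (((∏ j, ∑ l, C (a j l) * X ^ (d l) : ℝ[X]) * (X * derivative (X * derivative (∏ j, ∑ l, C (a j l) * X ^ (d l) : ℝ[X])))
        - (X * derivative (∏ j, ∑ l, C (a j l) * X ^ (d l) : ℝ[X])) ^ 2).roots.toFinset.filter (fun t => u < t ∧ t < v)).card ≤ 2 := by
  classical
  have hd0 : ∀ l, d 0 ≤ d l := fun l => hd.monotone (Fin.zero_le l)
  set lam : Fin (n + 1) → ℕ := fun l => d l.succ - d 0 with hlam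
  set W : ℝ[X] := (∏ j, ∑ l, C (a j l) * X ^ (d l) : ℝ[X]) * (X * derivative (X * derivative (∏ j, ∑ l, C (a j l) * X ^ (d l) : ℝ[X])))
      - (X * derivative (∏ j, ∑ l, C (a j l) * X ^ (d l) : ℝ[X])) ^ 2 with hWdef
  by_contra hgt
  push Not at hgt
  obtain ⟨y₁, hy₁, y₂, hy₂, y₃, hy₃, h12', h23⟩ := exists_three_lt_of_card (T := W.roots.toFinset.filter (fun t => u < t ∧ t < v)) hgt
  by_cases hW0 : W = 0
  · rw [hW0, roots_zero, Multiset.toFinset_zero, Finset.filter_empty] at hy₁; exact absurd hy₁ (Finset.notMem_empty _)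
  rw [mem_filter, Multiset.mem_toFinset, mem_roots hW0] at hy₁ hy₂ hy₃
  have hI : ∀ x ∈ Set.Icc y₁ y₃, x ∈ Ioo u v := fun x hx => ⟨hy₁.2.1.trans_le hx.1, lt_of_le_of_lt hx.2 hy₃.2.2⟩
  have hrowne : ∀ x ∈ Ioo u v, ∀ j, a j 0 - ∑ l : Fin (n + 1), (-(a j l.succ)) * x ^ (lam l) ≠ 0 := by
    intro x hx j
    by_cases hj : j = j₀
    · subst hj; exact (oneBump_bump_law d hd (a j) hbump (hu.trans hx.1)).1
    · exact (oneBump_background_law d hd (a j) hu (hrow j hj) hx).1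
  have hf : ∀ x ∈ Ioo u v, ∀ j, (∑ l, C (a j l) * X ^ (d l) : ℝ[X]).eval x ≠ 0 := by
    intro x hx j
    rw [eval_rowK_eq d hd0 (a j) x]
    exact mul_ne_zero (pow_ne_zero _ (hu.trans hx.1).ne') (hrowne x hx j)
  set s : Finset (Fin m) := Finset.univ.erase j₀ with hs
  set P : ℝ → ℝ := fun x => ∑ j ∈ s, rowPsiK1 lam (a j 0) (fun l : Fin (n + 1) => -(a j l.succ)) x with hP
  set P₁ : ℝ → ℝ := fun x => ∑ j ∈ s, rowPsiK2 lam (a j 0) (fun l : Fin (n + 1) => -(a j l.succ)) x with hP₁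
  set P₂ : ℝ → ℝ := fun x => ∑ j ∈ s, rowPsiK3 lam (a j 0) (fun l : Fin (n + 1) => -(a j l.succ)) x with hP₂
  set bb : ℝ → ℝ := fun x => rowPsiK1 lam (a j₀ 0) (fun l : Fin (n + 1) => -(a j₀ l.succ)) x with hbb
  set bb₁ : ℝ → ℝ := fun x => rowPsiK2 lam (a j₀ 0) (fun l : Fin (n + 1) => -(a j₀ l.succ)) x with hbb₁
  set bb₂ : ℝ → ℝ := fun x => rowPsiK3 lam (a j₀ 0) (fun l : Fin (n + 1) => -(a j₀ l.succ)) x with hbb₂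
  have hsum : ∀ x ∈ ({y₁, y₂, y₃} : Set ℝ), bb x + P x = 0 := by
    intro x hx
    have hxI : x ∈ Ioo u v := by
      simp only [Set.mem_insert_iff, Set.mem_singleton_iff] at hx
      rcases hx with h | h | h <;> subst h
      · exact hy₁.2
      · exact hy₂.2
      · exact hy₃.2
    have hx0 : 0 < x := hu.trans hxI.1
    have h : W.eval x = 0 := by
      simp only [Set.mem_insert_iff, Set.mem_singleton_iff] at hx
      rcases hx with h | h | h <;> subst h
      · exact hy₁.1
      · exact hy₂.1
      · exact hy₃.1
    rw [hWdef, logWronskian_prodK_eq_rowPsiK1_sum d hd0 a hx0 (hf x hxI)] at h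
    have hPne : ((∏ j, (∑ l, C (a j l) * X ^ (d l) : ℝ[X])).eval x) ≠ 0 := by
      rw [eval_prod]; exact Finset.prod_ne_zero_iff.2 fun j _ => hf x hxI j
    rcases mul_eq_zero.1 h with h1 | h1
    · exact absurd (neg_eq_zero.1 h1) (pow_ne_zero 2 hPne)
    · rw [← Finset.add_sum_erase Finset.univ _ (Finset.mem_univ j₀)] at h1
      exact h1
  rcases Finset.eq_empty_or_nonempty s with hs0 | hsne
  · have h := hsum y₁ (by simp)
    have : P y₁ = 0 := by simp only [hP, hs0, Finset.sum_empty]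
    rw [this, add_zero] at h
    exact absurd h (oneBump_bump_law d hd (a j₀) hbump (hu.trans hy₁.2.1)).2.1.ne
  refine no_three_zeros_bump_vs_logConvex bb bb₁ bb₂ P P₁ P₂ (hu.trans hy₁.2.1) h12' h23 ?_ ?_ ?_ ?_ ?_ ?_ ?_ ?_ hsum
  · intro x hx; exact (oneBump_bump_law d hd (a j₀) hbump (hu.trans (hI x hx).1)).2.1
  · intro x hx
    exact hasDerivAt_rowPsiK1 lam (a j₀ 0) (fun l : Fin (n + 1) => -(a j₀ l.succ)) (hu.trans (hI x hx).1).ne' (hrowne x (hI x hx) j₀)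
  · intro x hx
    exact hasDerivAt_rowPsiK2 lam (a j₀ 0) (fun l : Fin (n + 1) => -(a j₀ l.succ)) (hu.trans (hI x hx).1).ne' (hrowne x (hI x hx) j₀)
  · intro x hx; exact (oneBump_bump_law d hd (a j₀) hbump (hu.trans (hI x hx).1)).2.2
  · intro x hx
    obtain ⟨j₁, hj₁⟩ := hsne
    have hj₁' : j₁ ≠ j₀ := Finset.ne_of_mem_erase hj₁
    exact Finset.sum_pos' (fun j hj => (oneBump_background_law d hd (a j) hu (hrow j (Finset.ne_of_mem_erase hj)) (hI x hx)).2.1.le)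
      ⟨j₁, hj₁, (oneBump_background_law d hd (a j₁) hu (hrow j₁ hj₁') (hI x hx)).2.1⟩
  · intro x hx
    have hx0 : x ≠ 0 := (hu.trans (hI x hx).1).ne'
    have h := HasDerivAt.fun_sum (u := s)
      (fun j hj => hasDerivAt_rowPsiK1 lam (a j 0) (fun l : Fin (n + 1) => -(a j l.succ)) hx0 (hrowne x (hI x hx) j))
    show HasDerivAt (fun y => ∑ j ∈ s, rowPsiK1 lam (a j 0) (fun l : Fin (n + 1) => -(a j l.succ)) y)
      ((∑ j ∈ s, rowPsiK2 lam (a j 0) (fun l : Fin (n + 1) => -(a j l.succ)) x) / x) x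
    simpa only [Finset.sum_div] using h
  · intro x hx
    have hx0 : x ≠ 0 := (hu.trans (hI x hx).1).ne'
    have h := HasDerivAt.fun_sum (u := s)
      (fun j hj => hasDerivAt_rowPsiK2 lam (a j 0) (fun l : Fin (n + 1) => -(a j l.succ)) hx0 (hrowne x (hI x hx) j))
    show HasDerivAt (fun y => ∑ j ∈ s, rowPsiK2 lam (a j 0) (fun l : Fin (n + 1) => -(a j l.succ)) y)
      ((∑ j ∈ s, rowPsiK3 lam (a j 0) (fun l : Fin (n + 1) => -(a j l.succ)) x) / x) x
    simpa only [Finset.sum_div] using h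
  · intro x hx
    exact lc_sum s _ _ _ (fun j hj => (oneBump_background_law d hd (a j) hu (hrow j (Finset.ne_of_mem_erase hj)) (hI x hx)).2.1.le)
      (fun j hj => (oneBump_background_law d hd (a j) hu (hrow j (Finset.ne_of_mem_erase hj)) (hI x hx)).2.2.2)
      (fun j hj => (oneBump_background_law d hd (a j) hu (hrow j (Finset.ne_of_mem_erase hj)) (hI x hx)).2.2.1)

end ProductPlusOne

end Summit.ValiantsHypothesis.ValiantsHypothesis.Theorems.LacunarySymmetroidMatrixDescartes
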